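import Mathlib.CategoryTheory.ObjectProperty.Equivalence
import Literature.AlgebraicGeometry.Frobenioids.IsotropicFrobenioid
import Literature.AlgebraicGeometry.Frobenioids.IsoSubanchorNotIsotropic
import Literature.AlgebraicGeometry.Frobenioids.EquivalenceTransportAnchors
import Literature.AlgebraicGeometry.Frobenioids.PreFrobenioidDataOfFunctor
import Literature.AlgebraicGeometry.Frobenioids.DivisorMonoidCategoryTheoreticityDefs
import HarnessLib

/-!
# Frobenioids I, Remark 4.5.1 (standard-type half): `C` of standard type ⇒ `C^istr` of standard
# type (PROVED for Frobenioids)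

Mochizuki, *The geometry of Frobenioids I: the general theory*, Kyushu J. Math. **62** (2008)
293–400, kurims text p. 86 ll. 24–26 [cite: MochizukiFrdI2008, Rem. 4.5.1 p.86]: "We observe in
passing that it is immediate from the definitions that if `C` is of rationally standard type
(respectively, of standard type), then so is `C^istr`." (verbatim; the proof below uses, beyond the
definitions, Prop. 1.9 (v) — `C^istr` is a Frobenioid — and Remark 3.1.1, which is our unpacking of
"immediate from the definitions", not the author's wording). Proof-only companion of
`DivisorMonoidCategoryTheoreticityDefs.lean` (seat abc-iut-L1-t3, statement
`PreFrobenioidData.Remark451` untouched); abc-iut node `FrdI:Rmk4.5.1`. v2: docstring-only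
repair of the quotation (referee abc-iut-ref-c PASS C6 finding C6-F4); declarations byte-identical.

BINDING (finding R451-F1 to the typer, no statement change requested). The typed statement
`S.Remark451 SI : S.IsOfStandardType → SI.IsOfStandardType` is a SCHEMA over free operations
`SI : PreFrobenioidData S.Istr D` on the full subcategory `C^istr` (print: "[equipped with the
restriction to `C^istr` of the given functor `C → F_Φ`]", Prop. 1.9 (v) p. 32): junk `SI` make
it false, so it is discharged here for THE restriction. In the vocabulary of the cell's
Def. 1.1–1.3 files: for a Frobenioid `F : C → F_Φ` (found's `PreFrobenioid.IsFrobenioid`),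
`S := ofFunctor Φ F` (the §3–§4 adapter) and `SI := ofFunctor Φ (S.istrι ⋙ F)` (the operations
of the restricted functor `C^istr ↪ C → F_Φ`), `remark451_holds : S.Remark451 SI`.

The proof goes clause by clause through Def. 3.1 (i): (a) quasi-isotropic — every
object of `C^istr` is isotropic in `C^istr` and `C^istr` has no iso-subanchors (Remark 3.1.1 for
the Frobenioid `C^istr`, Prop. 1.9 (v) = L1-t1's `isFrobenioid_istr`, transported along the
identification of this file's `S.Istr` with L1-t1's `Istr F` — the same full subcategory cut out
by propositionally equal object properties — by L1-t13's `IsIsoSubanchor.map_equivalence`);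
Frobenius-isotropic (a Frobenius-type arrow of `C` out of an isotropic object is one of
`C^istr`); (b) if `C^istr` is of group-like type then so is `C` (`Φ(Base A) ≅ Φ(Base A^istr)`
along the isotropic hull, Def. 1.3 (vii)(a)), and a Frobenius-compact isotropic object of `C` is
Frobenius-compact in `C^istr` (`Aut`, `O^×` are computed in `C`, p. 56); (c) Frobenius-normalized
(endomorphisms are computed in `C`); (d), (e) concern `D` and `Φ` only. The "rationally
standard" half of the Remark is not typed in `Remark451` and is not treated here. No statement
of the paper is strengthened; nothing here bears on [IUTchIII] Cor. 3.12.

Throughout, `ofFunctor Φ F` are the §3–§4 operations of `F : C → F_Φ` and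
`ofFunctor Φ ((ofFunctor Φ F).istrι ⋙ F)` those of the restriction `C^istr ↪ C → F_Φ` over the
§3–§4 full subcategory `(ofFunctor Φ F).Istr` (written out in full: proof-only file, no
abbreviations).
-/

namespace Literature.AlgebraicGeometry.Frobenioids

open CategoryTheory Opposite

universe w v v' u u'

namespace PreFrobenioid

variable {D : Type u} [Category.{v} D] {Φ : Dᵒᵖ ⥤ CommMonCat.{w}} {C : Type u'}
  [Category.{v'} C] (F : C ⥤ ElemFrobenioid Φ)

open PreFrobenioidData (ofFunctor)

/-! ### The restriction to `C^istr`: compatibilities (Prop. 1.9 (v)) -/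

/-- Every object of `C^istr` is isotropic with respect to the restricted operations (an isometric
pre-step of `C^istr` is one of `C`, hence an isomorphism of `C`, hence of the full subcategory).
[cite: MochizukiFrdI2008, Prop. 1.9 (v) p.32] -/
theorem isIsotropic_istrData (A : (ofFunctor Φ F).Istr) :
    (ofFunctor Φ ((ofFunctor Φ F).istrι ⋙ F)).IsIsotropic A :=
  fun _ φ hφ => (ObjectProperty.isIso_hom_iff φ).mp (A.property φ.hom hφ)

/-- Co-angularity passes from `C` to `C^istr` (factorisations in the full subcategory are
factorisations in `C`). [cite: MochizukiFrdI2008, Prop. 1.9 (v) p.32] -/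
theorem isCoAngular_istrData_of {A B : (ofFunctor Φ F).Istr} (f : A ⟶ B)
    (h : (ofFunctor Φ F).IsCoAngular f.hom) :
    (ofFunctor Φ ((ofFunctor Φ F).istrι ⋙ F)).IsCoAngular f := by
  intro X Y γ β α hfac hα hβ hbi
  exact (ObjectProperty.isIso_hom_iff β).mp
    (h γ.hom β.hom α.hom (congrArg InducedCategory.Hom.hom hfac) hα hβ hbi)

/-- Frobenius type passes from `C` to `C^istr`. [cite: MochizukiFrdI2008, Prop. 1.9 (v) p.32] -/
theorem isFrobeniusType_istrData_of {A B : (ofFunctor Φ F).Istr} (f : A ⟶ B)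
    (h : (ofFunctor Φ F).IsFrobeniusType f.hom) :
    (ofFunctor Φ ((ofFunctor Φ F).istrι ⋙ F)).IsFrobeniusType f :=
  ⟨⟨isCoAngular_istrData_of F f h.1.1, h.1.2⟩, h.2⟩

/-- The §3–§4 full subcategory `(ofFunctor Φ F).Istr` and L1-t1's `Istr F` are cut out by
(propositionally) the same object property: `ofFunctor`-isotropic implies `F`-isotropic …
[cite: MochizukiFrdI2008, Prop. 1.9 (v) p.32] -/
theorem isotropicObjects_ofFunctor_le : (ofFunctor Φ F).isotropicObjects ≤ isotropicObjects F :=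
  fun A h => (PreFrobenioidData.ofFunctor_isIsotropic F A).mp h

/-- … and conversely. [cite: MochizukiFrdI2008, Prop. 1.9 (v) p.32] -/
theorem isotropicObjects_le_ofFunctor : isotropicObjects F ≤ (ofFunctor Φ F).isotropicObjects :=
  fun A h => (PreFrobenioidData.ofFunctor_isIsotropic F A).mpr h

/-- `C^istr` (of a Frobenioid) has no iso-subanchors: Remark 3.1.1 for the Frobenioid `C^istr`
(Prop. 1.9 (v)), which is of isotropic type — transported from L1-t1's `Istr F` along the
equivalence induced by the identity on objects. [cite: MochizukiFrdI2008, Rem. 3.1.1 p.57] -/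
theorem not_isIsoSubanchor_istrData (hF : IsFrobenioid F) (A : (ofFunctor Φ F).Istr) :
    ¬ IsIsoSubanchor A := by
  intro hA
  haveI : (ObjectProperty.ιOfLE (isotropicObjects_ofFunctor_le F)).IsEquivalence :=
    (ObjectProperty.isEquivalence_ιOfLE_iff _).mpr
      (fun X hX => ObjectProperty.le_isoClosure _ _ (isotropicObjects_le_ofFunctor F X hX))
  have h :=
    hA.map_equivalence (ObjectProperty.ιOfLE (isotropicObjects_ofFunctor_le F)).asEquivalence
  exact not_isIsoSubanchor_of_isOfIsotropicType (isFrobenioid_istr hF) isOfIsotropicType_istr _ h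

/-- If `C^istr` is of group-like type then so is `C`: `Φ(Base A) → Φ(Base A₁)` is bijective along
the isotropic hull `A → A₁` (a base-isomorphism, Def. 1.3 (vii)(a)).
[cite: MochizukiFrdI2008, Def. 1.3 (vii) p.24] -/
theorem isOfGroupLikeType_of_istrData (hF : IsFrobenioid F)
    (h : (ofFunctor Φ ((ofFunctor Φ F).istrι ⋙ F)).IsOfGroupLikeType) :
    (ofFunctor Φ F).IsOfGroupLikeType := by
  refine ⟨fun X x => ?_⟩
  obtain ⟨X₁, k, hk⟩ := hF.vii_a X
  have hX₁ : (ofFunctor Φ F).IsIsotropic X₁ :=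
    (PreFrobenioidData.ofFunctor_isIsotropic F X₁).mpr hk.2.2.1
  haveI : IsIso ((ofFunctor Φ F).base.map k) := hk.2.1.2
  have h1 : (ofFunctor Φ F).pull (inv ((ofFunctor Φ F).base.map k)) x = 1 := h.obj ⟨X₁, hX₁⟩ _
  calc x = (ofFunctor Φ F).pull (𝟙 _) x := ((ofFunctor Φ F).pull_id _ x).symm
    _ = (ofFunctor Φ F).pull ((ofFunctor Φ F).base.map k ≫ inv ((ofFunctor Φ F).base.map k)) x := by
          rw [IsIso.hom_inv_id]
    _ = (ofFunctor Φ F).pull ((ofFunctor Φ F).base.map k)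
          ((ofFunctor Φ F).pull (inv ((ofFunctor Φ F).base.map k)) x) :=
          (ofFunctor Φ F).pull_comp _ _ x
    _ = 1 := by rw [h1, map_one]

/-- A Frobenius-compact object of `C` lying in `C^istr` is Frobenius-compact in `C^istr`:
`Aut_{C^istr}(A) = Aut_C(A)` and `O^×` agree (full subcategory; as the typed Def. 3.1 (i)(b) of
`BaseCategoryTheoreticityDefs.lean` notes, Frobenius-compactness only involves `Aut_C(A)` and `O^×(A)`).
[cite: MochizukiFrdI2008, Def. 3.1 (i) p.56] -/
theorem isFrobeniusCompact_istrData_of (A : (ofFunctor Φ F).Istr)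
    (h : (ofFunctor Φ F).IsFrobeniusCompact A.obj) :
    (ofFunctor Φ ((ofFunctor Φ F).istrι ⋙ F)).IsFrobeniusCompact A := by
  obtain ⟨hcomm, ⟨u₀, hu₀, hnt⟩, hlam⟩ := h
  -- `Aut_{C^istr}(A) ≃ Aut_C(A)` as groups, respecting `O^×`
  let e : Aut A ≃* Aut A.obj :=
    { toFun := fun α => (ofFunctor Φ F).isotropicObjects.ι.mapIso α
      invFun := fun β => (ofFunctor Φ F).isotropicObjects.isoMk β
      left_inv := fun α => Iso.ext rfl
      right_inv := fun β => Iso.ext rfl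
      map_mul' := fun α β => Iso.ext rfl }
  have hmem : ∀ α : Aut A, α ∈ (ofFunctor Φ ((ofFunctor Φ F).istrι ⋙ F)).unitsSubgroup A ↔
      e α ∈ (ofFunctor Φ F).unitsSubgroup A.obj :=
    fun _ => Iff.rfl
  refine ⟨?_, ?_, ?_⟩
  · intro u hu u' hu'
    apply e.injective
    rw [map_mul, map_mul]
    exact hcomm _ ((hmem u).mp hu) _ ((hmem u').mp hu')
  · refine ⟨e.symm u₀, (hmem _).mpr (by rw [MulEquiv.apply_symm_apply]; exact hu₀),
      fun N hN hN1 => hnt N hN ?_⟩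
    have h' := congrArg e hN1
    rwa [map_pow, MulEquiv.apply_symm_apply, map_one] at h'
  · intro f p q hyp u hu
    have hyp' : ∀ v ∈ (ofFunctor Φ F).unitsSubgroup A.obj,
        ∃ N : ℕ, 0 < N ∧ ((e f * v * (e f)⁻¹) ^ (q : ℕ)) ^ N = (v ^ (p : ℕ)) ^ N := by
      intro v hv
      obtain ⟨N, hN, hEq⟩ :=
        hyp (e.symm v) ((hmem _).mpr (by rw [MulEquiv.apply_symm_apply]; exact hv))
      refine ⟨N, hN, ?_⟩
      have h' := congrArg e hEq
      simpa only [map_pow, map_mul, map_inv, MulEquiv.apply_symm_apply] using h'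
    obtain ⟨N, hN, hEq⟩ := hlam (e f) p q hyp' (e u) ((hmem u).mp hu)
    refine ⟨N, hN, e.injective ?_⟩
    simpa only [map_pow, map_mul, map_inv] using hEq

/-- A Frobenius-normalized object of `C` lying in `C^istr` is Frobenius-normalized in `C^istr`
(`End`, `O^▷`, `deg_Fr`, `Base` are computed in `C`). [cite: MochizukiFrdI2008, Prop. 1.9 (v) p.32] -/
theorem isFrobeniusNormalized_istrData_of (A : (ofFunctor Φ F).Istr)
    (h : (ofFunctor Φ F).IsFrobeniusNormalized A.obj) :
    (ofFunctor Φ ((ofFunctor Φ F).istrι ⋙ F)).IsFrobeniusNormalized A := by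
  intro φ hφ α hα
  let ι : End A →* End A.obj :=
    { toFun := fun a => a.hom, map_one' := rfl, map_mul' := fun _ _ => rfl }
  have hι : Function.Injective ι := fun a b hab => ObjectProperty.hom_ext _ hab
  apply hι
  rw [map_mul, map_mul, map_pow]
  exact h φ.hom hφ α.hom hα

/-! ### Remark 4.5.1 -/

/-- **Remark 4.5.1**, standard half (PROVED): for a Frobenioid `C → F_Φ` of standard type,
`C^istr` with the restricted structure is of standard type — clause by clause of Def. 3.1 (i):
quasi-isotropic (all objects isotropic, no iso-subanchors by Rem. 3.1.1 + Prop. 1.9 (v)),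
Frobenius-isotropic, (b) via `C^istr` group-like ⇒ `C` group-like, Frobenius-normalized, and
(d)(e) unchanged (FrdI p. 86: "it is immediate from the definitions").
[cite: MochizukiFrdI2008, Rem. 4.5.1 p.86] -/
theorem isOfStandardType_istrData (hF : IsFrobenioid F) (hS : (ofFunctor Φ F).IsOfStandardType) :
    (ofFunctor Φ ((ofFunctor Φ F).istrι ⋙ F)).IsOfStandardType where
  quasiIsotropic := ⟨fun A => ⟨fun h => (h (isIsotropic_istrData F A)).elim,
    fun h => (not_isIsoSubanchor_istrData F hF A h).elim⟩⟩
  frobeniusIsotropic := ⟨fun A => by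
    obtain ⟨B, φ, hφ, hB⟩ := hS.frobeniusIsotropic.obj A.obj
    exact ⟨⟨B, hB⟩, ObjectProperty.homMk φ, isFrobeniusType_istrData_of F _ hφ,
      isIsotropic_istrData F _⟩⟩
  frobeniusCompact_of_groupLike := fun hGL => by
    obtain ⟨A, hA, hAc⟩ :=
      hS.frobeniusCompact_of_groupLike (isOfGroupLikeType_of_istrData F hF hGL)
    exact ⟨⟨A, hA⟩, isIsotropic_istrData F _, isFrobeniusCompact_istrData_of F ⟨A, hA⟩ hAc⟩
  frobeniusNormalized := ⟨fun A =>
    isFrobeniusNormalized_istrData_of F A (hS.frobeniusNormalized.obj A.obj)⟩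
  fsmff := hS.fsmff
  nonDilating := ⟨hS.nonDilating.nonDilating⟩

/-- **Remark 4.5.1** AS TYPED (`PreFrobenioidData.Remark451 S SI`; node `FrdI:Rmk4.5.1`),
discharged for the operations `S = ofFunctor Φ F` of every Frobenioid `F : C → F_Φ` and THE
restricted operations `SI = ofFunctor Φ (S.istrι ⋙ F)` on `C^istr`: if `C` is of standard type
then so is `C^istr` (FrdI p. 86). The schema is not closed for junk `SI` (see the module
docstring, finding R451-F1). [cite: MochizukiFrdI2008, Rem. 4.5.1 p.86] -/
theorem remark451_holds (hF : IsFrobenioid F) :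
    PreFrobenioidData.Remark451 (ofFunctor Φ F) (ofFunctor Φ ((ofFunctor Φ F).istrι ⋙ F)) :=
  fun hS => isOfStandardType_istrData F hF hS

end PreFrobenioid

end Literature.AlgebraicGeometry.Frobenioids
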